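import Summits.QuantumFields.BalabanUV.Beta.GAN24.WSlotT2TablesAn1
import Summits.QuantumFields.BalabanUV.Gaps.CapTailLimitNecessary
import Summits.QuantumFields.BalabanUV.Gaps.CapSignsNecessaryFwd
import Summits.QuantumFields.BalabanUV.Gaps.CapTailFloors

/-!
# Gaps / CapTailPinnedLimitSign — AT THE PINNED LITERAL `JsBalAn1`, AT A FIXED BLOCK SIZE, the β⁰-side input of END grade (rung L1.2, the
# headline's β-currency) is the SIGN OF THE LIMIT `0 < lim_j β⁰_j`, and of Theorem-2 grade it is «all signs + the sign of the limit» — both read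
# off the tree's HYPOTHESIS-FREE all-scales rate for the literal (cell pub-balaban-gaps, seat g1-p3 gen 5, CAP+tail «split ∕ weakening» charge;
# fixed-block companion of `CapBlockTowerDrift` §3–§4 (there: up the block tower, the sign of the limit is the WHOLE β-side content))

HONEST FRAMING (cell rule, page 1 of everything): bookkeeping over hypothesis SHAPES and typed objects of the tree's β sub-cell; NOTHING of
Bałaban's is asserted beyond print; [Balaban1987RG1] Thm 2 is UNPROVED IN PRINT and enters only as hypothesis ∕ conclusion `B12.Thm2Printed C L`;
`EndpointExistence` is the cell's END-grade statement (existence of a tuned bare coupling), not a printed theorem; the positivity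
`0 < lim_j β⁰_j` for the pinned literal is the IDENTIFICATION residual of row (D1) ((P6)∕(W-L-2)) in SIGN form — OPEN (§4: it is IMPLIED by the
wall `D1Drift`, never proved here); the dictionary `hβ : S.β0 j = secondMoment (TbalOf Lc (JsBalAn1 …) j) μ ν` (the construction's one-loop
coefficients ARE the literal's) is the sub-cell's READING CLAUSE (W-KKT-2) turned into a binder; (D4) enters as `EverySlope`, (U)∕(L)∕(C) as
binders; provisional units (P6′) inside an2's definitions by name; 0 coefficients certified; 0∕6 binders discharged; one finite T⁴; NOT `BetaPertH`,
NOT the continuum limit, NOT Clay.  HONEST DEPENDENCY (b2b cell, verbatim): «continuum YM on T⁴ ⇐ BetaPertH ∧ nine spine estimates (0/9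
proved); BetaPertH ⇐ (D1) ∧ (D4) ∧ CAP+tail; G-an2-4 gates asym, D1 and NE2/3/4.»

THE POINT.  gan24-p1's `GAN24.WSlotT2TablesAn1.allScalesSeq_secondMoment_JsBalAn1_pinned` gives, with NO hypothesis beyond `2 ≤ Lc`, the box
root and the colour constants ∕ table by value, `∃ κ θ, 0 ≤ θ < 1 ∧ AllScalesSeq (j ↦ β⁰_j) κ θ` for the literal; hence (§1) `β⁰_j → lim`
(`tendsto_pinned`), a `GeomRate` at the limit with SOME constants (`exists_geomRate_pinned`), and from `0 < lim` an EVENTUAL FLOOR `lim∕2`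
(`eventualFloor_of_pinned_limPos`).  So (§2) **`endpointExistence_of_pinned_limPos`**: END grade for every forward-generated construction whose
split carries the literal's coefficients (`hβ`), from `0 < lim` + `EverySlope` + (U)∕(L)∕(C) — gen 2's `CapTailFloors.endpointExistence_of_eventualFloor_everySlope`;
compare the β sub-cell's `AveragedAFCarrierJsBalAn1.wallEND_of_cauchy_eq_JsBalAn1_cont_allProfiles` ∕ `…_of_D1Drift_…`, whose β⁰-side binder is the
IDENTIFICATION `hident` ∕ the WALL `D1Drift` (and which deliver MORE: the horizon facts with the printed slope).  (§3) Theorem-2 grade at the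
fixed block: `thm2Printed_of_pinned_allSigns_limPos` (ALL signs `0 < β⁰_j` + `0 < lim`; the CAP cannot be truncated to a computable `k₀` here
because `κ, θ` sit inside the tree's `∃` — row tail «numeric n₀ unreachable») and the NECESSITY `limPos_and_signs_of_thm2Printed_pinned` ∕ the
residue `thm2Printed_pinned_iff` (gen 3's `CapSignsNecessaryFwd.thm2Printed_iff_allSigns_and_limit_pos_fwd`).  (§4) THE WALL IMPLIES THE SIGN:
`limPos_of_D1Drift_pinned` (`D1Drift Lc (JsBalAn1 …) N μ ν`, `0 < N` ⟹ `0 < lim`, asym1's `CauchyRate.lim_pos_of_drift_stepBal`) — the sign binder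
is WEAKER than the wall; (§5) indeed at the literal the wall IS the single identity `lim β⁰_j = stepBal N Lc` (`d1Drift_pinned_iff_lim_eq`: the defect
bound comes for free from the hypothesis-free rate; scalar form of gan24-p1's `d1Drift_iff_three_JsBalAn1_pinned`).
READING for rows (D1) ∕ tail ∕ B3: at the pinned literal and a FIXED block size, the headline-relevant END grade asks of the β⁰-side exactly the
SIGN of the limit (plus (D4)∕(U)∕(L)∕(C) and the dictionary `hβ`); the literal (0.31) asks in addition ALL early signs (the CAP, untruncatable
without explicit κ, θ); up the block tower (`CapBlockTowerDrift`) the early signs drop out.  RELEVANCE: `EndpointExistence D.C.toB12` is the β-binder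
`hEnd` of the print-faithful headline `T4ContinuumYM4Torus.continuumYM4_torus_of_endpointExistence` (binders `hD` (B1), `hB` (B), `hEnd`, `hNE` (NE7-slot); plan-2 N-c); for constructions carrying the pinned literal's
coefficients it is thus SUPPLIED by `0 < lim β⁰_j` (+ (D4)∕(U)∕(L)∕(C)) — and `CapTailEndNecessity` shows it FORCES `0 ≤ lim β⁰_j`.
0 sorry; 0 def; imports tree files only.

CITATION HEADER (tags CONTEXT ONLY).  [I] = T. Bałaban, Commun. Math. Phys. **109** (1987) [Balaban1987RG1]: Thm 2 p. 259 with (0.31); (1.22)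
p. 264; (2.12)–(2.14) p. 268; (0.20) p. 256.
-/

namespace Summit.QuantumFields.BalabanUV.Gaps.CapTailPinnedLimitSign

open Literature.MathematicalPhysics.QuantumFieldTheory.Balaban1983to89
open Literature.MathematicalPhysics.QuantumFieldTheory.Balaban1983to89.FlowStep
open Literature.MathematicalPhysics.QuantumFieldTheory.Balaban1983to89.FlowStepRuns
open Literature.MathematicalPhysics.QuantumFieldTheory.Balaban1983to89.DagBinding
open Literature.MathematicalPhysics.QuantumFieldTheory.Balaban1983to89.Beta
open Literature.MathematicalPhysics.QuantumFieldTheory.Balaban1983to89.Beta.RateCertificate (GeomRate CauchyRate)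
open Literature.MathematicalPhysics.QuantumFieldTheory.Balaban1983to89.Beta.RemainderConstAllScales (AllScalesSeq)
open Literature.MathematicalPhysics.QuantumFieldTheory.Balaban1983to89.Beta.OneStepKernelFamily (TbalOf D1Drift)
open Literature.MathematicalPhysics.QuantumFieldTheory.Balaban1983to89.Beta.AffineAveraging (box)
open Summit.QuantumFields.BalabanUV.Gaps.CapSignsConstRoad (EverySlope)
open Summit.QuantumFields.BalabanUV.Beta.MixedJetTablesPlug (JsBalAn1)
open Summit.QuantumFields.BalabanUV.Beta.GAN24.WSlotT2TablesAn1 (allScalesSeq_secondMoment_JsBalAn1_pinned)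
open Summit.QuantumFields.BalabanUV.Beta.GAN24.StencilSlotOfE3 (one_le_of_two_le)
open Filter Topology

noncomputable section

variable {Lc : ℕ} [NeZero Lc]

/-! ## §1 Tail facts at the pinned literal, hypothesis-free (from gan24-p1's all-scales rate) -/

/-- **A `GeomRate` AT THE LIMIT WITH SOME CONSTANTS** for the literal's one-loop coefficients: all-scales ⟹ Cauchy ⟹ `GeomRate b (lim b) (κ∕(1−θ)) θ`
(`AllScalesSeq.cauchyRate`, `CauchyRate.geomRate`).  The constants are NOT numbers (inside the tree's `∃`). [folklore] -/
theorem exists_geomRate_pinned (hLc : 2 ≤ Lc) {r : Fin (3 + 1) → ℕ} (hr : r ∈ box (3 + 1) Lc) (cE cVH cΛ cB : ℝ)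
    (Tc : Fin 4 → Fin 4 → Fin 4 → Fin 4 → ℝ) (μ ν : Fin 4) :
    ∃ c₀ θ : ℝ, 0 ≤ θ ∧ θ < 1 ∧ GeomRate
      (fun j => B12Beta.secondMoment (TbalOf Lc (JsBalAn1 (one_le_of_two_le hLc) hr cE cVH cΛ ((Lc : ℝ) ^ (2 * (3 + 1))) cB Tc) j) μ ν)
      (CauchyRate.lim (fun j => B12Beta.secondMoment
        (TbalOf Lc (JsBalAn1 (one_le_of_two_le hLc) hr cE cVH cΛ ((Lc : ℝ) ^ (2 * (3 + 1))) cB Tc) j) μ ν)) c₀ θ := by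
  obtain ⟨κ, θ, hθ0, hθ1, hall⟩ := allScalesSeq_secondMoment_JsBalAn1_pinned hLc hr cE cVH cΛ cB Tc μ ν
  exact ⟨_, θ, hθ0, hθ1, hall.cauchyRate.geomRate hθ1⟩

/-- **CONVERGENCE** of the literal's one-loop coefficients to `CauchyRate.lim` (hypothesis-free). [folklore] -/
theorem tendsto_pinned (hLc : 2 ≤ Lc) {r : Fin (3 + 1) → ℕ} (hr : r ∈ box (3 + 1) Lc) (cE cVH cΛ cB : ℝ)
    (Tc : Fin 4 → Fin 4 → Fin 4 → Fin 4 → ℝ) (μ ν : Fin 4) :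
    Tendsto (fun j => B12Beta.secondMoment (TbalOf Lc (JsBalAn1 (one_le_of_two_le hLc) hr cE cVH cΛ ((Lc : ℝ) ^ (2 * (3 + 1))) cB Tc) j) μ ν)
      atTop (𝓝 (CauchyRate.lim (fun j => B12Beta.secondMoment
        (TbalOf Lc (JsBalAn1 (one_le_of_two_le hLc) hr cE cVH cΛ ((Lc : ℝ) ^ (2 * (3 + 1))) cB Tc) j) μ ν))) := by
  obtain ⟨c₀, θ, hθ0, hθ1, h⟩ := exists_geomRate_pinned hLc hr cE cVH cΛ cB Tc μ ν
  exact h.tendsto hθ0 hθ1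

/-- **EVENTUAL FLOOR FROM THE SIGN OF THE LIMIT**: `0 < lim` ⟹ `∃ k₀, ∀ j ≥ k₀, lim∕2 ≤ β⁰_j` (hypothesis-free convergence + `0 < lim`).
[folklore] -/
theorem eventualFloor_of_pinned_limPos (hLc : 2 ≤ Lc) {r : Fin (3 + 1) → ℕ} (hr : r ∈ box (3 + 1) Lc) (cE cVH cΛ cB : ℝ)
    (Tc : Fin 4 → Fin 4 → Fin 4 → Fin 4 → ℝ) (μ ν : Fin 4)
    (hlim : 0 < CauchyRate.lim (fun j => B12Beta.secondMoment
        (TbalOf Lc (JsBalAn1 (one_le_of_two_le hLc) hr cE cVH cΛ ((Lc : ℝ) ^ (2 * (3 + 1))) cB Tc) j) μ ν)) :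
    ∃ k₀ : ℕ, ∀ j, k₀ ≤ j → CauchyRate.lim (fun j => B12Beta.secondMoment
        (TbalOf Lc (JsBalAn1 (one_le_of_two_le hLc) hr cE cVH cΛ ((Lc : ℝ) ^ (2 * (3 + 1))) cB Tc) j) μ ν) / 2 ≤
      B12Beta.secondMoment (TbalOf Lc (JsBalAn1 (one_le_of_two_le hLc) hr cE cVH cΛ ((Lc : ℝ) ^ (2 * (3 + 1))) cB Tc) j) μ ν := by
  have h := (tendsto_pinned hLc hr cE cVH cΛ cB Tc μ ν).eventually_const_lt (half_lt_self hlim)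
  obtain ⟨k₀, hk₀⟩ := eventually_atTop.mp h
  exact ⟨k₀, fun j hj => (hk₀ j hj).le⟩

/-! ## §2 END grade at the pinned literal from the SIGN of the limit (fixed block size, no composition hypothesis) -/

variable {β : HBeta}

/-- **END GRADE AT THE PINNED LITERAL FROM `0 < lim β⁰_j`**: a construction forward-generated by `β` whose split `S` carries the literal's
one-loop coefficients (`hβ`, the reading clause as a binder), `0 < lim`, `EverySlope S γc` ((D4) currency), (U), the lower bound (L) `−β′ ≤ β`
on the boxes, (C) ⟹ `EndpointExistence C` — via the eventual floor `lim∕2` and gen 2's `CapTailFloors.endpointExistence_of_eventualFloor_everySlope`.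
NO identification `lim = stepBal`, NO defect bound, NO sign of any early coefficient.  Compare the β sub-cell's `wallEND_of_…_JsBalAn1…` ENDs
(β⁰-side binder = the WALL; they deliver the horizon facts with the printed slope, which this does not).
[cite: Balaban1987RG1, Thm 2 p.259 (first sentence) and (1.22) p.264] -/
theorem endpointExistence_of_pinned_limPos (hLc : 2 ≤ Lc) {r : Fin (3 + 1) → ℕ} (hr : r ∈ box (3 + 1) Lc) (cE cVH cΛ cB : ℝ)
    (Tc : Fin 4 → Fin 4 → Fin 4 → Fin 4 → ℝ) (μ ν : Fin 4) {C : B12.Construction} (hgen : ForwardGenerated C β)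
    (S : B12Beta.OneLoopSplit β)
    (hβ : ∀ j, S.β0 j = B12Beta.secondMoment
        (TbalOf Lc (JsBalAn1 (one_le_of_two_le hLc) hr cE cVH cΛ ((Lc : ℝ) ^ (2 * (3 + 1))) cB Tc) j) μ ν)
    (hlim : 0 < CauchyRate.lim (fun j => B12Beta.secondMoment
        (TbalOf Lc (JsBalAn1 (one_le_of_two_le hLc) hr cE cVH cΛ ((Lc : ℝ) ^ (2 * (3 + 1))) cB Tc) j) μ ν))
    {γc β' : ℝ} (hrem : EverySlope S γc) (hup : BetaUpperH β' γc β) (hlo : ∀ k, ∀ v ∈ Box γc k, -β' ≤ β k v)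
    (hcont : BetaContH γc β) : EndpointExistence C := by
  obtain ⟨k₀, hk₀⟩ := eventualFloor_of_pinned_limPos hLc hr cE cVH cΛ cB Tc μ ν hlim
  exact CapTailFloors.endpointExistence_of_eventualFloor_everySlope hgen S (half_pos hlim)
    (fun k hk => (hβ k).symm ▸ hk₀ k hk) hrem hup hlo hcont

/-! ## §3 Theorem-2 grade at the pinned literal, fixed block size: all signs + the sign of the limit, and the necessity -/

/-- **(0.31) AT THE PINNED LITERAL FROM ALL SIGNS + THE SIGN OF THE LIMIT**: `∀ j, 0 < β⁰_j`, `0 < lim`, `EverySlope`, (C), (U), forward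
generation ⟹ `B12.Thm2Printed C L` (gen 3's `CapTailLimitNecessary.thm2Printed_of_allSigns_tendsto` on the hypothesis-free convergence).  At the
literal the CAP cannot be truncated to a computable `k₀`: the rate constants sit inside the tree's `∃`. [cite: Balaban1987RG1, Thm 2 (0.31) p.259] -/
theorem thm2Printed_of_pinned_allSigns_limPos (hLc : 2 ≤ Lc) {r : Fin (3 + 1) → ℕ} (hr : r ∈ box (3 + 1) Lc) (cE cVH cΛ cB : ℝ)
    (Tc : Fin 4 → Fin 4 → Fin 4 → Fin 4 → ℝ) (μ ν : Fin 4) {C : B12.Construction} (hgen : ForwardGenerated C β) {L : ℝ}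
    (hL : 1 < L) (S : B12Beta.OneLoopSplit β)
    (hβ : ∀ j, S.β0 j = B12Beta.secondMoment
        (TbalOf Lc (JsBalAn1 (one_le_of_two_le hLc) hr cE cVH cΛ ((Lc : ℝ) ^ (2 * (3 + 1))) cB Tc) j) μ ν)
    (hpos : ∀ j, 0 < S.β0 j)
    (hlim : 0 < CauchyRate.lim (fun j => B12Beta.secondMoment
        (TbalOf Lc (JsBalAn1 (one_le_of_two_le hLc) hr cE cVH cΛ ((Lc : ℝ) ^ (2 * (3 + 1))) cB Tc) j) μ ν))
    {γc β' : ℝ} (hrem : EverySlope S γc) (hcont : BetaContH γc β) (hup : BetaUpperH β' γc β) : B12.Thm2Printed C L := by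
  have ht := tendsto_pinned hLc hr cE cVH cΛ cB Tc μ ν
  rw [show (fun j => B12Beta.secondMoment
        (TbalOf Lc (JsBalAn1 (one_le_of_two_le hLc) hr cE cVH cΛ ((Lc : ℝ) ^ (2 * (3 + 1))) cB Tc) j) μ ν) = S.β0
      from (funext hβ).symm] at ht hlim
  exact CapTailLimitNecessary.thm2Printed_of_allSigns_tendsto hgen hL S hpos ht hlim hrem hcont hup

/-- **NECESSITY AT THE PINNED LITERAL** (forward generation + `EverySlope` only): `B12.Thm2Printed C L` forces `0 < lim β⁰_j` AND `0 ≤ β⁰_j`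
for every `j` (gen 3's `CapSignsNecessaryFwd.eventualFloor_of_thm2Printed_tendsto_fwd` ∕ `beta0_nonneg_of_thm2Printed_fwd_everySlope`).
[cite: Balaban1987RG1, Thm 2 (0.31) p.259] -/
theorem limPos_and_signs_of_thm2Printed_pinned (hLc : 2 ≤ Lc) {r : Fin (3 + 1) → ℕ} (hr : r ∈ box (3 + 1) Lc) (cE cVH cΛ cB : ℝ)
    (Tc : Fin 4 → Fin 4 → Fin 4 → Fin 4 → ℝ) (μ ν : Fin 4) {C : B12.Construction} (hgen : ForwardGenerated C β)
    (S : B12Beta.OneLoopSplit β)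
    (hβ : ∀ j, S.β0 j = B12Beta.secondMoment
        (TbalOf Lc (JsBalAn1 (one_le_of_two_le hLc) hr cE cVH cΛ ((Lc : ℝ) ^ (2 * (3 + 1))) cB Tc) j) μ ν)
    {γc : ℝ} (hrem : EverySlope S γc) {L : ℝ} (hL : 1 < L) (h : B12.Thm2Printed C L) :
    0 < CauchyRate.lim (fun j => B12Beta.secondMoment
        (TbalOf Lc (JsBalAn1 (one_le_of_two_le hLc) hr cE cVH cΛ ((Lc : ℝ) ^ (2 * (3 + 1))) cB Tc) j) μ ν) ∧
      ∀ j, 0 ≤ S.β0 j := by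
  have ht := tendsto_pinned hLc hr cE cVH cΛ cB Tc μ ν
  rw [show (fun j => B12Beta.secondMoment
        (TbalOf Lc (JsBalAn1 (one_le_of_two_le hLc) hr cE cVH cΛ ((Lc : ℝ) ^ (2 * (3 + 1))) cB Tc) j) μ ν) = S.β0
      from (funext hβ).symm] at ht ⊢
  exact ⟨(CapSignsNecessaryFwd.eventualFloor_of_thm2Printed_tendsto_fwd hgen S hrem ht hL h).1,
    CapSignsNecessaryFwd.beta0_nonneg_of_thm2Printed_fwd_everySlope hgen S hrem hL h⟩

/-- **THE RESIDUE OF (0.31) AT THE PINNED LITERAL, FIXED BLOCK SIZE** (off the boundary `β⁰_j ≠ 0`; forward generation, `EverySlope`, (C), (U)):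
`B12.Thm2Printed C L ↔ (∀ j, 0 < β⁰_j) ∧ 0 < lim β⁰_j` — ALL SIGNS (the untruncated CAP) and the SIGN OF THE LIMIT (the tail); the rate itself is
free (hypothesis-free in the tree). [cite: Balaban1987RG1, Thm 2 (0.31) p.259] -/
theorem thm2Printed_pinned_iff (hLc : 2 ≤ Lc) {r : Fin (3 + 1) → ℕ} (hr : r ∈ box (3 + 1) Lc) (cE cVH cΛ cB : ℝ)
    (Tc : Fin 4 → Fin 4 → Fin 4 → Fin 4 → ℝ) (μ ν : Fin 4) {C : B12.Construction} (hgen : ForwardGenerated C β)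
    (S : B12Beta.OneLoopSplit β)
    (hβ : ∀ j, S.β0 j = B12Beta.secondMoment
        (TbalOf Lc (JsBalAn1 (one_le_of_two_le hLc) hr cE cVH cΛ ((Lc : ℝ) ^ (2 * (3 + 1))) cB Tc) j) μ ν)
    {γc β' : ℝ} (hrem : EverySlope S γc) (hcont : BetaContH γc β) (hup : BetaUpperH β' γc β) {L : ℝ} (hL : 1 < L)
    (hne : ∀ j, S.β0 j ≠ 0) :
    B12.Thm2Printed C L ↔ (∀ j, 0 < S.β0 j) ∧ 0 < CauchyRate.lim (fun j => B12Beta.secondMoment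
        (TbalOf Lc (JsBalAn1 (one_le_of_two_le hLc) hr cE cVH cΛ ((Lc : ℝ) ^ (2 * (3 + 1))) cB Tc) j) μ ν) := by
  have ht := tendsto_pinned hLc hr cE cVH cΛ cB Tc μ ν
  rw [show (fun j => B12Beta.secondMoment
        (TbalOf Lc (JsBalAn1 (one_le_of_two_le hLc) hr cE cVH cΛ ((Lc : ℝ) ^ (2 * (3 + 1))) cB Tc) j) μ ν) = S.β0
      from (funext hβ).symm] at ht ⊢
  exact CapSignsNecessaryFwd.thm2Printed_iff_allSigns_and_limit_pos_fwd hgen S ht hrem hcont hup hL hne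

/-! ## §4 The wall implies the sign: `D1Drift` ⟹ `0 < lim` -/

/-- **THE SIGN BINDER IS WEAKER THAN THE WALL**: `D1Drift Lc (JsBalAn1 …) N μ ν` (the β sub-cell's wall v2.21 for the literal: partial sums within
`A` of the line with slope `stepBal N Lc`) with `0 < N` ⟹ `0 < lim β⁰_j` (asym1's `CauchyRate.lim_pos_of_drift_stepBal` on the hypothesis-free
Cauchy rate; `1 < Lc` from `2 ≤ Lc`).  Nothing here proves the wall. [folklore] -/
theorem limPos_of_D1Drift_pinned (hLc : 2 ≤ Lc) {r : Fin (3 + 1) → ℕ} (hr : r ∈ box (3 + 1) Lc) (cE cVH cΛ cB : ℝ)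
    (Tc : Fin 4 → Fin 4 → Fin 4 → Fin 4 → ℝ) (μ ν : Fin 4) {N : ℝ} (hN : 0 < N)
    (hD : D1Drift Lc (JsBalAn1 (one_le_of_two_le hLc) hr cE cVH cΛ ((Lc : ℝ) ^ (2 * (3 + 1))) cB Tc) N μ ν) :
    0 < CauchyRate.lim (fun j => B12Beta.secondMoment
        (TbalOf Lc (JsBalAn1 (one_le_of_two_le hLc) hr cE cVH cΛ ((Lc : ℝ) ^ (2 * (3 + 1))) cB Tc) j) μ ν) := by
  obtain ⟨κ, θ, -, hθ1, hall⟩ := allScalesSeq_secondMoment_JsBalAn1_pinned hLc hr cE cVH cΛ cB Tc μ ν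
  obtain ⟨A, hA⟩ := hD
  have hLc1 : (1 : ℝ) < (Lc : ℝ) := by exact_mod_cast (lt_of_lt_of_le one_lt_two hLc)
  exact hall.cauchyRate.lim_pos_of_drift_stepBal hθ1 hA hN hLc1

/-- **END GRADE AT THE PINNED LITERAL FROM THE WALL, through the sign** (composition of §4 and §2): `D1Drift` (+ `0 < N`) + the dictionary `hβ` +
`EverySlope` + (U)∕(L)∕(C) + forward generation ⟹ `EndpointExistence C`.  The β sub-cell's own `wallEND_of_D1Drift_JsBalAn1_cont_allProfiles`
reaches END (and more) from the wall with (D4) STRICT `r < stepBal`; this corollary records that the END part passes through the SIGN of the limit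
alone. [cite: Balaban1987RG1, Thm 2 p.259 (first sentence) and (1.22) p.264] -/
theorem endpointExistence_of_D1Drift_pinned_viaSign (hLc : 2 ≤ Lc) {r : Fin (3 + 1) → ℕ} (hr : r ∈ box (3 + 1) Lc)
    (cE cVH cΛ cB : ℝ) (Tc : Fin 4 → Fin 4 → Fin 4 → Fin 4 → ℝ) (μ ν : Fin 4) {N : ℝ} (hN : 0 < N)
    (hD : D1Drift Lc (JsBalAn1 (one_le_of_two_le hLc) hr cE cVH cΛ ((Lc : ℝ) ^ (2 * (3 + 1))) cB Tc) N μ ν)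
    {C : B12.Construction} (hgen : ForwardGenerated C β) (S : B12Beta.OneLoopSplit β)
    (hβ : ∀ j, S.β0 j = B12Beta.secondMoment
        (TbalOf Lc (JsBalAn1 (one_le_of_two_le hLc) hr cE cVH cΛ ((Lc : ℝ) ^ (2 * (3 + 1))) cB Tc) j) μ ν)
    {γc β' : ℝ} (hrem : EverySlope S γc) (hup : BetaUpperH β' γc β) (hlo : ∀ k, ∀ v ∈ Box γc k, -β' ≤ β k v)
    (hcont : BetaContH γc β) : EndpointExistence C :=
  endpointExistence_of_pinned_limPos hLc hr cE cVH cΛ cB Tc μ ν hgen S hβ (limPos_of_D1Drift_pinned hLc hr cE cVH cΛ cB Tc μ ν hN hD)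
    hrem hup hlo hcont

/-! ## §5 At the pinned literal the WALL is ONE real-number identity: `D1Drift ↔ lim β⁰_j = stepBal N Lc` -/

/-- **THE WALL AT THE PINNED LITERAL IS A SINGLE IDENTITY OF REALS**: because the all-scales rate is hypothesis-free, `D1Drift Lc (JsBalAn1 …) N μ ν`
(partial sums within SOME `A` of the line with slope `stepBal N Lc`) holds IFF `CauchyRate.lim (j ↦ β⁰_j) = stepBal N Lc` — the defect bound comes
for free (`→`: asym1's `CauchyRate.lim_eq_of_drift`, Cesàro; `←`: `GeomRate.drift` at the limit, defect `c₀∕(1−θ)`).  The β sub-cell states the same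
equivalence in its limit-KERNEL currency (`GAN24.WSlotT2TablesAn1.d1Drift_iff_three_JsBalAn1_pinned`); this is the scalar form.  Its SIGN half
(`0 < lim`) carries END grade (§2) and the tower (`CapBlockTowerDrift` §3); its VALUE half carries the printed slope of the horizon facts.
Nothing here proves either side. [folklore] -/
theorem d1Drift_pinned_iff_lim_eq (hLc : 2 ≤ Lc) {r : Fin (3 + 1) → ℕ} (hr : r ∈ box (3 + 1) Lc) (cE cVH cΛ cB : ℝ)
    (Tc : Fin 4 → Fin 4 → Fin 4 → Fin 4 → ℝ) (μ ν : Fin 4) (N : ℝ) :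
    D1Drift Lc (JsBalAn1 (one_le_of_two_le hLc) hr cE cVH cΛ ((Lc : ℝ) ^ (2 * (3 + 1))) cB Tc) N μ ν ↔
      CauchyRate.lim (fun j => B12Beta.secondMoment
        (TbalOf Lc (JsBalAn1 (one_le_of_two_le hLc) hr cE cVH cΛ ((Lc : ℝ) ^ (2 * (3 + 1))) cB Tc) j) μ ν) =
        B12Normalization.stepBal N Lc := by
  obtain ⟨κ, θ, hθ0, hθ1, hall⟩ := allScalesSeq_secondMoment_JsBalAn1_pinned hLc hr cE cVH cΛ cB Tc μ ν
  refine ⟨fun ⟨A, hA⟩ => hall.cauchyRate.lim_eq_of_drift hθ1 hA, fun h => ?_⟩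
  have hg := hall.cauchyRate.geomRate hθ1
  rw [h] at hg
  exact ⟨_, hg.drift hθ0 hθ1⟩

end

end Summit.QuantumFields.BalabanUV.Gaps.CapTailPinnedLimitSign
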